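import Summits.Ventures.PercRepro.RankDistLubell

/-!
# PercRepro — THE LUBELL WEIGHTS OF THE RANK LEVELS, II: LUBELL MONOTONICITY — `W_u ≤ W_{u+1}` for every finite
matroid and every `u < ρ(E)` (p9, gen 20)

THEOREM L of proofs/P9-S4-UPSET-g20.md §6, in the kernel: for every finite matroid `M` of rank `p` on `n` elements,
the Lubell weights `W_u = Σ_{A ⊆ E, ρ(A) = u} 1 / C(n, |A|)` of the rank levels are nondecreasing in `u`
(`lubellW_le_succ`, `lubellW_mono`) — a linear inequality between the coefficients `c_{u,k} = #{A : |A| = k, ρ(A) = u}`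
of the rank generating polynomial, `Σ_k c_{u,k} / C(n, k) ≤ Σ_k c_{u+1,k} / C(n, k)`, valid for EVERY matroid (the
plain one-step `(n − u)·c_u ≤ (u + 1)·c_{u+1}` of the rank distribution is false in general).
Proof (static form of the random-chain argument). With `N_u = Σ_{ρ(S) = u} ω(S)·Ψ(S)` (`RankDistLubell`):
`N_{u+1} = Σ ω(S')·Ψ(S')` is the total weight of the triples `(S', x, S)` — `x` a coloop of `S'`, `S` a spanning
subset of `S' ∖ x` (`lubellN_succ_eq_sum_tripleT`, the spanning-subset identity on `S' ∖ x`); the map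
`(S, Y, x) ↦ (S ∪ Y ∪ {x}, x, S)` from the triples `S` of rank `u`, `Y ⊆ cl(S) ∖ S`, `x ∈ E ∖ cl(S)` is injective
into them (`tripleMap_mem`, `tripleMap_injOn`) with weight `ω(S)·|Y|!·Ψ(S ∪ Y ∪ {x})`; and for each `S` and `Y`,
`Σ_{x ∉ cl(S)} Ψ(S ∪ Y ∪ {x}) ≥ (n − |S| − |Y|)!` because `(n − |cl(S')| + 1)·Ψ(S') = (n − |S'| + 1)!` and
`cl(S') ⊇ cl(S) ∪ {x}` (`plateauW_mul`, `plateauW_le_sum`) — so `N_u ≤ N_{u+1}` (`lubellN_le_succ`).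
Nothing here moves any window of the crux.
-/

namespace PercRepro.RankDist

open Set Finset _root_.Matroid PercRepro.ThmH

variable {α : Type} [DecidableEq α] (M : Matroid α) [M.Finite]

/-! ## The plateau weight in closed form -/

/-- `Ψ(S) = Φ(|cl(S) ∖ S|, n − |cl(S)|)` for `S ⊆ E`. -/
lemma plateauW_eq_plateauSum {S : Finset α} (hS : S ⊆ gr M) :
    plateauW M S = plateauSum (clF M S \ S).card ((gr M).card - (clF M S).card) := by
  unfold plateauW plateauSum
  rw [Finset.sum_powerset_apply_card (fun j => j.factorial * ((gr M).card - S.card - j).factorial)]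
  refine Finset.sum_congr rfl fun j hj => ?_
  rw [smul_eq_mul, ← mul_assoc]
  congr 2
  have h1 : (clF M S \ S).card = (clF M S).card - S.card :=
    Finset.card_sdiff_of_subset (subset_clF M ((subset_gr_iff M).1 hS))
  have h2 : (clF M S).card ≤ (gr M).card := Finset.card_le_card (clF_subset_gr M S)
  have h3 : S.card ≤ (clF M S).card := Finset.card_le_card (subset_clF M ((subset_gr_iff M).1 hS))
  omega

/-- `(n − |cl(S)| + 1)·Ψ(S) = (n − |S| + 1)!` for `S ⊆ E`. -/
lemma plateauW_mul {S : Finset α} (hS : S ⊆ gr M) :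
    ((gr M).card - (clF M S).card + 1) * plateauW M S = ((gr M).card - S.card + 1).factorial := by
  rw [plateauW_eq_plateauSum M hS, plateauSum_mul]
  congr 1
  have h1 : (clF M S \ S).card = (clF M S).card - S.card :=
    Finset.card_sdiff_of_subset (subset_clF M ((subset_gr_iff M).1 hS))
  have h2 : (clF M S).card ≤ (gr M).card := Finset.card_le_card (clF_subset_gr M S)
  have h3 : S.card ≤ (clF M S).card := Finset.card_le_card (subset_clF M ((subset_gr_iff M).1 hS))
  omega

omit [DecidableEq α] in
/-- The natural rank of the ground set is `p`. -/
lemma rk_ground_eq {p : ℕ} (hr : M.eRank = (p : ℕ∞)) : rk M M.E = p := by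
  have := eRk_eq_coe_rk M (subset_refl M.E)
  rw [← M.eRank_def, hr] at this
  exact_mod_cast this.symm

omit [DecidableEq α] in
/-- A rank-`u` set with `u < ρ(E)` has `|cl(S)| < n`. -/
lemma card_clF_lt {p u : ℕ} (hr : M.eRank = (p : ℕ∞)) (hup : u < p) {S : Finset α}
    (hS : S ∈ rankLevelFin M u) : (clF M S).card < (gr M).card := by
  obtain ⟨hSE, hSu⟩ := (mem_rankLevelFin M).1 hS
  refine lt_of_le_of_ne (Finset.card_le_card (clF_subset_gr M S)) fun heq => ?_
  have hcl : clF M S = gr M := Finset.eq_of_subset_of_card_le (clF_subset_gr M S) heq.ge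
  have hrkE : rk M ((gr M : Finset α) : Set α) = rk M (S : Set α) :=
    (rk_eq_iff_subset_clF M hSE (by rw [coe_gr])).2 hcl.symm.subset
  rw [coe_gr, hSu, rk_ground_eq M hr] at hrkE
  omega

/-- The one-element extension `S' = S ∪ Y ∪ {x}` of a rank-`u` set: its rank is `u + 1`, `x` is a coloop of it,
`S` is a spanning subset of `S' ∖ x`, and `|S'| = |S| + |Y| + 1`. -/
lemma insert_union_facts {u : ℕ} {S Y : Finset α} {x : α} (hS : S ∈ rankLevelFin M u)
    (hY : Y ⊆ clF M S \ S) (hx : x ∈ gr M \ clF M S) :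
    insert x (S ∪ Y) ∈ rankLevelFin M (u + 1) ∧ x ∈ coloopsOf M (insert x (S ∪ Y)) ∧
      S ∈ spanningSubsets M ((insert x (S ∪ Y)).erase x) ∧ (insert x (S ∪ Y)).card = S.card + Y.card + 1 := by
  obtain ⟨hSE, hSu⟩ := (mem_rankLevelFin M).1 hS
  rw [Finset.mem_sdiff] at hx
  have hYcl : Y ⊆ clF M S := hY.trans Finset.sdiff_subset
  have hSYcl : S ∪ Y ⊆ clF M S := Finset.union_subset (subset_clF M ((subset_gr_iff M).1 hSE)) hYcl
  have hxSY : x ∉ S ∪ Y := fun h => hx.2 (hSYcl h)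
  have hSYE : S ∪ Y ⊆ gr M := hSYcl.trans (clF_subset_gr M S)
  have hrkSY : rk M ((S ∪ Y : Finset α) : Set α) = u := by
    rw [← hSu]
    exact (rk_eq_iff_subset_clF M Finset.subset_union_left ((subset_gr_iff M).1 hSYE)).2 hSYcl
  have hxcl : x ∉ M.closure ((S ∪ Y : Finset α) : Set α) := by
    intro hmem
    apply hx.2
    rw [mem_clF]
    have : M.closure ((S ∪ Y : Finset α) : Set α) ⊆ M.closure (M.closure (S : Set α)) :=
      M.closure_subset_closure fun e he => (mem_clF M).1 (hSYcl (Finset.mem_coe.1 he))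
    rw [M.closure_closure] at this
    exact this hmem
  have hxE : x ∈ M.E := by
    have := hx.1
    rwa [← Finset.mem_coe, coe_gr] at this
  have hins : (insert x (S ∪ Y) : Finset α) ⊆ gr M := Finset.insert_subset hx.1 hSYE
  have hrk' : rk M ((insert x (S ∪ Y) : Finset α) : Set α) = u + 1 := by
    have h := M.eRk_insert_eq_add_one (e := x) (X := ((S ∪ Y : Finset α) : Set α)) ⟨hxE, hxcl⟩
    rw [← Finset.coe_insert, eRk_eq_coe_rk M ((subset_gr_iff M).1 hins),
      eRk_eq_coe_rk M ((subset_gr_iff M).1 hSYE), hrkSY] at h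
    exact_mod_cast h
  have herase : (insert x (S ∪ Y)).erase x = S ∪ Y := Finset.erase_insert hxSY
  refine ⟨(mem_rankLevelFin M).2 ⟨hins, hrk'⟩, ?_, ?_, ?_⟩
  · unfold coloopsOf
    rw [Finset.mem_filter, herase, hrkSY, hrk']
    exact ⟨Finset.mem_insert_self _ _, Nat.lt_succ_self _⟩
  · rw [herase, mem_spanningSubsets, hrkSY, hSu]
    exact ⟨Finset.subset_union_left, rfl⟩
  · rw [Finset.card_insert_of_notMem hxSY,
      Finset.card_union_of_disjoint (Finset.disjoint_of_subset_right hY Finset.disjoint_sdiff)]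

/-- The triples `(S', x, S)` as a sigma finset: `S'` of rank `u + 1`, `x` a coloop of `S'`, `S` spanning in
`S' ∖ x`. -/
noncomputable def tripleT (u : ℕ) : Finset (Σ _ : Finset α, Σ _ : α, Finset α) :=
  (rankLevelFin M (u + 1)).sigma fun S' => (coloopsOf M S').sigma fun x => spanningSubsets M (S'.erase x)

/-- The triples `(S, Y, x)` as a sigma finset: `S` of rank `u`, `Y ⊆ cl(S) ∖ S`, `x ∈ E ∖ cl(S)`. -/
noncomputable def tripleU (u : ℕ) : Finset (Σ _ : Finset α, Σ _ : Finset α, α) :=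
  (rankLevelFin M u).sigma fun S => (clF M S \ S).powerset.sigma fun _ => gr M \ clF M S

/-- The weight of a triple `(S', x, S)`: `ω(S)·(|S'| − 1 − |S|)!·Ψ(S')`. -/
noncomputable def tripleWeight (t : Σ _ : Finset α, Σ _ : α, Finset α) : ℕ :=
  omegaW M t.2.2 * (t.1.card - 1 - t.2.2.card).factorial * plateauW M t.1

/-- The map `(S, Y, x) ↦ (S ∪ Y ∪ {x}, x, S)`. -/
def tripleMap (t : Σ _ : Finset α, Σ _ : Finset α, α) : Σ _ : Finset α, Σ _ : α, Finset α :=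
  ⟨insert t.2.2 (t.1 ∪ t.2.1), t.2.2, t.1⟩

/-- **`N_{u+1}` as the total weight of the triples `(S', x, S)`**: `ω(S')` counts the orderings of `S'` ending in
a coloop `x`, and each ordering of `S' ∖ x` has a hitting prefix `S` (the spanning-subset identity). -/
lemma lubellN_succ_eq_sum_tripleT (u : ℕ) : lubellN M (u + 1) = ∑ t ∈ tripleT M u, tripleWeight M t := by
  rw [lubellN_eq_sum_omegaW, tripleT, Finset.sum_sigma]
  refine Finset.sum_congr rfl fun S' hS' => ?_
  rw [Finset.sum_sigma]
  obtain ⟨hS'E, hS'u⟩ := (mem_rankLevelFin M).1 hS'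
  have hne : S' ≠ ∅ := by
    rintro rfl
    simp [rk] at hS'u
  have hω : omegaW M S' = ∑ x ∈ coloopsOf M S', (S'.card - 1).factorial := by
    rw [omegaW, if_neg hne, Finset.sum_const, smul_eq_mul]
  rw [hω, Finset.sum_mul]
  refine Finset.sum_congr rfl fun x hx => ?_
  have hxS' : x ∈ S' := coloopsOf_subset M S' hx
  have hid := sum_omegaW_spanning M (S'.erase x)
    ((Finset.coe_subset.2 (Finset.erase_subset x S')).trans ((subset_gr_iff M).1 hS'E))
  rw [Finset.card_erase_of_mem hxS'] at hid
  rw [← hid, Finset.sum_mul]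
  rfl

/-- `tripleMap` sends `tripleU` into `tripleT`. -/
lemma tripleMap_mem {u : ℕ} {t : Σ _ : Finset α, Σ _ : Finset α, α} (ht : t ∈ tripleU M u) :
    tripleMap t ∈ tripleT M u := by
  obtain ⟨S, Y, x⟩ := t
  unfold tripleU at ht
  simp only [Finset.mem_sigma, Finset.mem_powerset] at ht
  obtain ⟨hS, hY, hx⟩ := ht
  obtain ⟨h1, h2, h3, -⟩ := insert_union_facts M hS hY hx
  unfold tripleT tripleMap
  simp only [Finset.mem_sigma]
  exact ⟨h1, h2, h3⟩

/-- `tripleMap` is injective on `tripleU`. -/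
lemma tripleMap_injOn (u : ℕ) : Set.InjOn (tripleMap (α := α)) (tripleU M u : Set (Σ _ : Finset α, Σ _ : Finset α, α)) := by
  rintro ⟨S₁, Y₁, x₁⟩ h₁ ⟨S₂, Y₂, x₂⟩ h₂ h
  rw [Finset.mem_coe] at h₁ h₂
  unfold tripleU at h₁ h₂
  simp only [Finset.mem_sigma, Finset.mem_powerset] at h₁ h₂
  unfold tripleMap at h
  simp only [Sigma.mk.injEq, heq_eq_eq] at h
  obtain ⟨hins, rfl, rfl⟩ := h
  -- recover `Y` from `S' = S ∪ Y ∪ {x}`: `Y = (S'.erase x) \ S`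
  suffices hY : Y₁ = Y₂ by rw [hY]
  have key : ∀ {Y : Finset α}, Y ⊆ clF M S₁ \ S₁ → x₁ ∈ gr M \ clF M S₁ →
      (insert x₁ (S₁ ∪ Y)).erase x₁ \ S₁ = Y := by
    intro Y hY hx
    rw [Finset.mem_sdiff] at hx
    have hYcl : Y ⊆ clF M S₁ := hY.trans Finset.sdiff_subset
    have hSYcl : S₁ ∪ Y ⊆ clF M S₁ :=
      Finset.union_subset (subset_clF M ((subset_gr_iff M).1 ((mem_rankLevelFin M).1 h₁.1).1)) hYcl
    have hxSY : x₁ ∉ S₁ ∪ Y := fun h => hx.2 (hSYcl h)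
    rw [Finset.erase_insert hxSY]
    exact Finset.union_sdiff_cancel_left (Finset.disjoint_of_subset_right hY Finset.disjoint_sdiff)
  have e1 := key h₁.2.1 h₁.2.2
  have e2 := key h₂.2.1 h₂.2.2
  rw [hins] at e1
  rw [← e1]
  exact e2

/-- The weight of the image triple: `ω(S)·|Y|!·Ψ(S ∪ Y ∪ {x})`. -/
lemma tripleWeight_tripleMap {u : ℕ} {t : Σ _ : Finset α, Σ _ : Finset α, α} (ht : t ∈ tripleU M u) :
    tripleWeight M (tripleMap t) = omegaW M t.1 * t.2.1.card.factorial * plateauW M (insert t.2.2 (t.1 ∪ t.2.1)) := by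
  obtain ⟨S, Y, x⟩ := t
  unfold tripleU at ht
  simp only [Finset.mem_sigma, Finset.mem_powerset] at ht
  obtain ⟨-, -, -, hcard⟩ := insert_union_facts M ht.1 ht.2.1 ht.2.2
  unfold tripleWeight tripleMap
  simp only
  rw [hcard]
  have h : S.card + Y.card + 1 - 1 - S.card = Y.card := by omega
  rw [h]

/-- **The key estimate for one rank-`u` set**: `Ψ(S) ≤ Σ_{Y ⊆ cl(S) ∖ S} Σ_{x ∈ E ∖ cl(S)} |Y|!·Ψ(S ∪ Y ∪ {x})`
(`u < ρ(E)`): the next flat `cl(S ∪ Y ∪ {x})` contains `cl(S) ∪ {x}`, so `(n − |cl(S')| + 1) ≤ n − |cl(S)|` and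
`(n − |cl(S')| + 1)·Ψ(S') = (n − |S| − |Y|)!`. -/
lemma plateauW_le_sum {p u : ℕ} (hr : M.eRank = (p : ℕ∞)) (hup : u < p) {S : Finset α}
    (hS : S ∈ rankLevelFin M u) :
    plateauW M S ≤ ∑ Y ∈ (clF M S \ S).powerset, ∑ x ∈ gr M \ clF M S,
      Y.card.factorial * plateauW M (insert x (S ∪ Y)) := by
  obtain ⟨hSE, -⟩ := (mem_rankLevelFin M).1 hS
  have hg : 0 < (gr M).card - (clF M S).card := Nat.sub_pos_of_lt (card_clF_lt M hr hup hS)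
  have hgcard : (gr M \ clF M S).card = (gr M).card - (clF M S).card :=
    Finset.card_sdiff_of_subset (clF_subset_gr M S)
  unfold plateauW
  refine Finset.sum_le_sum fun Y hY => ?_
  rw [Finset.mem_powerset] at hY
  rw [← Finset.mul_sum]
  refine Nat.mul_le_mul_left _ ?_
  -- `g · Σ_x Ψ(S') ≥ g · (n − |S| − |Y|)!`
  refine Nat.le_of_mul_le_mul_left ?_ hg
  rw [Finset.mul_sum]
  calc ((gr M).card - (clF M S).card) * ((gr M).card - S.card - Y.card).factorial
      = ∑ _x ∈ gr M \ clF M S, ((gr M).card - S.card - Y.card).factorial := by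
        rw [Finset.sum_const, smul_eq_mul, hgcard]
    _ ≤ ∑ x ∈ gr M \ clF M S, ((gr M).card - (clF M S).card) * plateauW M (insert x (S ∪ Y)) := by
        refine Finset.sum_le_sum fun x hx => ?_
        obtain ⟨h1, -, -, hcard⟩ := insert_union_facts M hS hY hx
        have hS'E : insert x (S ∪ Y) ⊆ gr M := ((mem_rankLevelFin M).1 h1).1
        have hmul := plateauW_mul M hS'E
        rw [hcard] at hmul
        have hle : (gr M).card - (clF M (insert x (S ∪ Y))).card + 1 ≤ (gr M).card - (clF M S).card := by
          -- `cl(S') ⊇ cl(S) ∪ {x}` with `x ∉ cl(S)`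
          have hsub : insert x (clF M S) ⊆ clF M (insert x (S ∪ Y)) := by
            refine Finset.insert_subset ?_ ((clF_mono M Finset.subset_union_left).trans
              (clF_mono M (Finset.subset_insert _ _)))
            exact subset_clF M ((subset_gr_iff M).1 hS'E) (Finset.mem_insert_self _ _)
          have hxcl : x ∉ clF M S := (Finset.mem_sdiff.1 hx).2
          have h2 := Finset.card_le_card hsub
          rw [Finset.card_insert_of_notMem hxcl] at h2
          have h3 : (clF M (insert x (S ∪ Y))).card ≤ (gr M).card :=
            Finset.card_le_card (clF_subset_gr M _)
          omega
        have hS'card : S.card + Y.card + 1 ≤ (gr M).card := by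
          rw [← hcard]; exact Finset.card_le_card hS'E
        have hfac : ((gr M).card - S.card - Y.card).factorial = ((gr M).card - (S.card + Y.card + 1) + 1).factorial := by
          congr 1; omega
        rw [hfac, ← hmul]
        exact Nat.mul_le_mul_right _ hle

/-- **LUBELL MONOTONICITY (integer form)**: `N_u ≤ N_{u+1}` for every `u < ρ(E)`. -/
theorem lubellN_le_succ {p u : ℕ} (hr : M.eRank = (p : ℕ∞)) (hup : u < p) : lubellN M u ≤ lubellN M (u + 1) := by
  rw [lubellN_eq_sum_omegaW, lubellN_succ_eq_sum_tripleT]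
  calc ∑ S ∈ rankLevelFin M u, omegaW M S * plateauW M S
      ≤ ∑ S ∈ rankLevelFin M u, omegaW M S * ∑ Y ∈ (clF M S \ S).powerset, ∑ x ∈ gr M \ clF M S,
          Y.card.factorial * plateauW M (insert x (S ∪ Y)) :=
        Finset.sum_le_sum fun S hS => Nat.mul_le_mul_left _ (plateauW_le_sum M hr hup hS)
    _ = ∑ t ∈ tripleU M u, tripleWeight M (tripleMap t) := by
        unfold tripleU
        rw [Finset.sum_sigma]
        refine Finset.sum_congr rfl fun S hS => ?_
        rw [Finset.mul_sum, Finset.sum_sigma]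
        refine Finset.sum_congr rfl fun Y hY => ?_
        rw [Finset.mul_sum]
        refine Finset.sum_congr rfl fun x hx => ?_
        rw [tripleWeight_tripleMap M (by
          unfold tripleU
          simp only [Finset.mem_sigma]
          exact ⟨hS, hY, hx⟩)]
        ring
    _ = ∑ t' ∈ (tripleU M u).image tripleMap, tripleWeight M t' := by
        rw [Finset.sum_image (tripleMap_injOn M u)]
    _ ≤ ∑ t' ∈ tripleT M u, tripleWeight M t' := by
        refine Finset.sum_le_sum_of_subset fun t' ht' => ?_
        obtain ⟨t, ht, rfl⟩ := Finset.mem_image.1 ht'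
        exact tripleMap_mem M ht

/-! ## The rational form -/

/-- **The Lubell weight of the rank level `u`**: `W_u = Σ_{A ⊆ E, ρ(A) = u} 1 / C(n, |A|)` — the expected number of
rank-`u` sets on a uniformly random maximal chain of subsets of `E`. -/
noncomputable def lubellW (u : ℕ) : ℚ :=
  ∑ A ∈ rankLevelFin M u, (1 : ℚ) / (((gr M).card).choose A.card : ℚ)

omit [DecidableEq α] in
/-- `n!·W_u = N_u`. -/
lemma factorial_mul_lubellW (u : ℕ) : ((gr M).card.factorial : ℚ) * lubellW M u = (lubellN M u : ℚ) := by
  unfold lubellW lubellN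
  rw [Finset.mul_sum, Nat.cast_sum]
  refine Finset.sum_congr rfl fun A hA => ?_
  have hAn : A.card ≤ (gr M).card := Finset.card_le_card ((mem_rankLevelFin M).1 hA).1
  have h := Nat.choose_mul_factorial_mul_factorial hAn
  have hpos : (0 : ℚ) < (((gr M).card).choose A.card : ℚ) := by exact_mod_cast Nat.choose_pos hAn
  rw [mul_one_div, div_eq_iff hpos.ne']
  have h' : (((gr M).card.factorial : ℕ) : ℚ) = ((((gr M).card).choose A.card * A.card.factorial * ((gr M).card - A.card).factorial : ℕ) : ℚ) := by
    rw [h]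
  rw [h']
  push_cast
  ring

/-- **LUBELL MONOTONICITY OF THE RANK DISTRIBUTION**: in every finite matroid of rank `p`, the Lubell weights
`W_u = Σ_{ρ(A) = u} 1/C(n, |A|)` of the rank levels are nondecreasing: `W_u ≤ W_{u+1}` for every `u < p`. -/
theorem lubellW_le_succ {p u : ℕ} (hr : M.eRank = (p : ℕ∞)) (hup : u < p) : lubellW M u ≤ lubellW M (u + 1) := by
  have hpos : (0 : ℚ) < ((gr M).card.factorial : ℚ) := by exact_mod_cast Nat.factorial_pos _
  have h := lubellN_le_succ M hr hup
  have h' : ((gr M).card.factorial : ℚ) * lubellW M u ≤ ((gr M).card.factorial : ℚ) * lubellW M (u + 1) := by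
    rw [factorial_mul_lubellW, factorial_mul_lubellW]
    exact_mod_cast h
  exact le_of_mul_le_mul_left h' hpos

/-- **Monotone over any range**: `W_a ≤ W_b` for `a ≤ b ≤ ρ(E)`. -/
theorem lubellW_mono {p a b : ℕ} (hr : M.eRank = (p : ℕ∞)) (hab : a ≤ b) (hbp : b ≤ p) :
    lubellW M a ≤ lubellW M b := by
  induction b, hab using Nat.le_induction with
  | base => exact le_rfl
  | succ k hak ih => exact (ih (by omega)).trans (lubellW_le_succ M hr (by omega))

end PercRepro.RankDist
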